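import Literature.Probability.LatticeModels.TorusBlockFourier
import HarnessLib

/-!
# Tight-binding FITS versus Wannier (Fourier) hoppings on the full `k`-grid

Topic `MathematicalPhysics/QuantumLattice` (cell `pub/hubbard-downfold`, MO-S1; the «INFL-TRUNC» axis of the router:
objects **M** = the Wannier Hamiltonian of the isolated band truncated at a printed range, **E** = a LEAST-SQUARES FIT of a
truncated tight-binding form `ε₀ − 2t(cos kₓ + cos k_y) − 4t′ cos kₓ cos k_y − …` to the band over a `k`-WINDOW
[MarkiewiczEtAl2005, Tables I–III; PavariniEtAl2001, Eq. (1)]).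

On the full uniform `L^d` grid of the discrete Brillouin zone `(ℤ/Lℤ)^d` a one-band dispersion is a function
`ε : (ℤ/L)^d → ℂ` and the tight-binding «regressors» are the characters `χ_R(k) = e^{2πi k·R/L}` of the hopping vectors `R`
(`Literature.Probability.LatticeModels.torusChar`; a real cosine band is the combination `χ_R + χ_{-R}`).  The exact content of
this file is the orthogonality bookkeeping behind the cell's INFL-TRUNC rulings:

* `TBFit.fourierHopping ε R = L^{-d} Σ_k ε(k) conj χ_R(k)` — the Wannier/Fourier hopping of the band (object M: for a one-band
  Wannier Hamiltonian `H(k) = Σ_R t(R) χ_R(k)` it IS `t(R)`, `fourierHopping_tbBand`);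
* `TBFit.residual ε S t = Σ_k ‖ε(k) − Σ_{R ∈ S} t(R) χ_R(k)‖²` — the FULL-GRID least-squares functional of a fit truncated to
  the hopping set `S` (object E with window = the whole zone);
* **`TBFit.residual_eq_residual_fourier_add`** (Pythagoras): for every coefficient vector `t`,
  `residual ε S t = residual ε S (fourierHopping ε) + L^d Σ_{R ∈ S} ‖t R − fourierHopping ε R‖²`;
* hence **`TBFit.residual_fourier_le`** / **`TBFit.eq_fourierHopping_of_residual_le`**: the full-grid fit is minimised
  EXACTLY and ONLY at the Fourier hoppings, WHATEVER the truncation set `S` — truncating the fitted RANGE does not bias the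
  fitted hoppings («E = M on the full grid»); the printed E–M differences are therefore a `k`-WINDOW (and weighting) effect,
  which is what `TBFit.windowResidual` (no orthogonality, no closed form) leaves open;
* **`TBFit.fourierHopping_tbBand`**: a band that IS a tight-binding band with hoppings supported on `S₀` returns exactly those
  hoppings and zero outside `S₀` (no aliasing on the full grid);
* **`TBFit.residual_fourier_tbBand`** (the truncation TAIL, Parseval): what truncation to `S` does change is the band, by
  exactly `L^d Σ_{R ∈ S₀ \ S} ‖t₀ R‖²` in full-grid mean square — monotone in `S` (`residual_fourier_tbBand_anti`) and zero
  once `S ⊇ S₀` (`residual_fourier_tbBand_of_subset`); for arbitrary trial hoppings the residual is tail + coefficient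
  mismatch (`residual_tbBand_eq_tail_add`);
* **`TBFit.windowFit_of_tbBand`** (window fits act only through the tail): if nothing is truncated (`S₀ ⊆ S`) and the
  truncated design separates hopping vectors on the window `W`, every minimiser of `windowResidual W` is the true hopping
  vector — the `k`-window moves fitted hoppings only jointly with a non-zero truncation tail
  (`windowResidual_tbBand_ite_mem`: at the true hoppings the window residual is the window's view of the tail band);
* **`TBFit.fourierHopping_latticeBand`** (mesh aliasing): a band with INTEGER hopping vectors `T ⊂ ℤ^d` sampled on the `L^d`
  mesh returns at each class the alias sum `TBFit.aliasSum` of the hoppings reducing to it (`…_of_injOn`: none when the mesh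
  separates `T`; `…_pair`: `2t″` for the `(±2,0)` pair on a 4-point mesh).

Everything is proved (0 facts, 0 sorry); the abstract orthogonal-family computation is done once (`section Abstract`) and
specialised to the torus characters.  Deliberately NOT here: the windowed normal equations' solution (depends on the window;
that dependence is the located INFL-TRUNC spread, e.g. La₂CuO₄ in-house objects M/E/F t′/t −0.08 … −0.14), real-cosine
repackaging, and any statement about which object a one-band Hubbard box should carry (the cell's letter: tags, not unions).

## Sources

R. S. Markiewicz, S. Sahrakorpi, M. Lindroos, Hsin Lin, A. Bansil, Phys. Rev. B 72, 054519 (2005), §II and Tables I–III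
(multi-parameter tight-binding fits to LDA and ARPES dispersions; `MarkiewiczEtAl2005`); E. Pavarini, I. Dasgupta,
T. Saha-Dasgupta, O. Jepsen, O. K. Andersen, Phys. Rev. Lett. 87, 047003 (2001), Eq. (1) (the one-band form;
`PavariniEtAl2001`); N. Marzari, A. A. Mostofi, J. R. Yates, I. Souza, D. Vanderbilt, Rev. Mod. Phys. 84, 1419 (2012), §II.A
eq. (3)–(4) (Wannier functions as lattice Fourier transforms of the Bloch gauge; `MarzariEtAl2012`); the least-squares statements are
the textbook discrete trigonometric least-squares theorem — G. Hämmerlin, K.-H. Hoffmann, *Numerical Mathematics* (Springer UTM,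
1991), Ch. 6 §6.1 (normal equations), §6.2 (unique solvability), §6.5 (equidistant data: orthogonal system,
`α̃_k = ⟨y, g_k⟩/‖g_k‖²`, best approximation for `n < N`, interpolation for `n = N`; `HammerlinHoffman1991`) — proved here in the
`(ℤ/L)^d`-character form; the alias mapping of a coarse mesh is C. D. Cantrell, *Modern Mathematical Methods for Physicists and
Engineers* (CUP, 2000), §8.5.5 Eq. (8.363) (`Cantrell2000`).  The orthogonality of
the characters is the tree's `Literature.Probability.LatticeModels.TorusBlock.sum_torusChar_mul_conj` [folklore].
-/

noncomputable section

namespace Literature.MathematicalPhysics.QuantumLattice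

open Finset Complex Literature.Probability.LatticeModels
open scoped ComplexConjugate

namespace TBFit

/-! ### Abstract orthogonal families: the least-squares Pythagoras identity -/

section Abstract

variable {ι κ : Type*} [Fintype κ] [DecidableEq ι]

/-- The model `Σ_{i ∈ S} a i · φ i k` built from a family of «regressors» `φ i : κ → ℂ` with coefficients `a`
truncated to the index set `S` (Hämmerlin–Hoffmann's `f̃ = Σ α_k g_k`). [cite: HammerlinHoffman1991, Ch. 6 §6.1] -/
def model (φ : ι → κ → ℂ) (S : Finset ι) (a : ι → ℂ) (k : κ) : ℂ :=
  ∑ i ∈ S, a i * φ i k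

/-- The projection coefficient `(Σ_k f k · conj (φ i k)) / c` of `f` on the regressor `φ i` when the family has the common
squared norm `c` (`α̃_k = ⟨y, g_k⟩ / ‖g_k‖²`). [cite: HammerlinHoffman1991, Ch. 6 §6.5] -/
def coeff (φ : ι → κ → ℂ) (c : ℂ) (f : κ → ℂ) (i : ι) : ℂ :=
  (∑ k, f k * conj (φ i k)) / c

/-- The least-squares functional `Σ_k ‖f k − model φ S a k‖²` (the discrete `L²` fitting problem).
[cite: HammerlinHoffman1991, Ch. 6 §6.1] -/
def lsq (φ : ι → κ → ℂ) (S : Finset ι) (f : κ → ℂ) (a : ι → ℂ) : ℝ :=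
  ∑ k, ‖f k - model φ S a k‖ ^ 2

variable {φ : ι → κ → ℂ} {c : ℂ}

/- Orthogonality hypothesis used below (written out in each statement, no auxiliary definition):
`hφ : ∀ i j, ∑ k, φ i k * conj (φ j k) = if i = j then c else 0`. -/

omit [Fintype κ] [DecidableEq ι] in
/-- `model` is linear in the coefficients: `model φ S (a − b) = model φ S a − model φ S b`. [folklore] -/
private theorem model_sub (S : Finset ι) (a b : ι → ℂ) (k : κ) :
    model φ S (fun i => a i - b i) k = model φ S a k - model φ S b k := by
  simp only [model, sub_mul, Finset.sum_sub_distrib]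

/-- Testing a model against a regressor of the family: `Σ_k conj (φ i k) · model φ S a k = c · a i` for `i ∈ S` and `0`
otherwise. [cite: HammerlinHoffman1991, Ch. 6 §6.5 (Orthogonality Relation; α̃_k = ⟨y, g_k⟩/‖g_k‖²)] -/
theorem sum_conj_mul_model (hφ : ∀ i j, ∑ k, φ i k * conj (φ j k) = if i = j then c else 0) (S : Finset ι) (a : ι → ℂ) (i : ι) :
    ∑ k, conj (φ i k) * model φ S a k = if i ∈ S then c * a i else 0 := by
  classical
  have h1 : ∀ k, conj (φ i k) * model φ S a k = ∑ j ∈ S, a j * (φ j k * conj (φ i k)) := by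
    intro k
    rw [model, Finset.mul_sum]
    refine Finset.sum_congr rfl fun j _ => ?_
    ring
  simp_rw [h1]
  rw [Finset.sum_comm]
  have h2 : ∀ j ∈ S, ∑ k, a j * (φ j k * conj (φ i k)) = a j * (if j = i then c else 0) := by
    intro j _
    rw [← Finset.mul_sum, hφ j i]
  rw [Finset.sum_congr rfl h2]
  simp_rw [mul_ite, mul_zero]
  rw [Finset.sum_ite_eq' S i]
  split_ifs with hi
  · ring
  · rfl

/-- The residual of the PROJECTION is orthogonal to every regressor in `S`:
`Σ_k (f k − model φ S (coeff φ c f) k) · conj (φ i k) = 0` for `i ∈ S` (requires `c ≠ 0`). [cite: HammerlinHoffman1991, Ch. 6 §6.1 (Normal Equations) and §6.5] -/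
theorem sum_residual_mul_conj_eq_zero (hφ : ∀ i j, ∑ k, φ i k * conj (φ j k) = if i = j then c else 0) (hc : c ≠ 0) (S : Finset ι) (f : κ → ℂ)
    {i : ι} (hi : i ∈ S) :
    ∑ k, (f k - model φ S (coeff φ c f) k) * conj (φ i k) = 0 := by
  simp_rw [sub_mul, Finset.sum_sub_distrib]
  have h1 : ∑ k, model φ S (coeff φ c f) k * conj (φ i k) = c * coeff φ c f i := by
    have := sum_conj_mul_model hφ S (coeff φ c f) i
    rw [if_pos hi] at this
    rw [← this]
    exact Finset.sum_congr rfl fun k _ => mul_comm _ _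
  rw [h1, coeff, mul_div_cancel₀ _ hc, sub_self]

/-- The squared norm of a model: `Σ_k ‖model φ S a k‖² = Re c · Σ_{i ∈ S} ‖a i‖²` for an orthogonal family. [cite: HammerlinHoffman1991, Ch. 6 §6.5 (Orthogonality Relation; α̃_k = ⟨y, g_k⟩/‖g_k‖²)] -/
theorem lsq_model (hφ : ∀ i j, ∑ k, φ i k * conj (φ j k) = if i = j then c else 0) (S : Finset ι) (a : ι → ℂ) :
    ∑ k, ‖model φ S a k‖ ^ 2 = c.re * ∑ i ∈ S, ‖a i‖ ^ 2 := by
  classical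
  -- Σ_k ‖m k‖² = Re Σ_k m k · conj (m k) = Re Σ_{i∈S} conj (a i) Σ_k conj(φ i k) m k = Re Σ_{i∈S} conj (a i) · c · a i
  have h1 : ∀ k, (‖model φ S a k‖ ^ 2 : ℝ) = (model φ S a k * conj (model φ S a k)).re := by
    intro k
    rw [Complex.mul_conj, Complex.ofReal_re, Complex.normSq_eq_norm_sq]
  simp_rw [h1]
  rw [← Complex.re_sum]
  have h2 : ∀ k, model φ S a k * conj (model φ S a k) = ∑ i ∈ S, conj (a i) * (conj (φ i k) * model φ S a k) := by
    intro k
    rw [show conj (model φ S a k) = ∑ i ∈ S, conj (a i) * conj (φ i k) by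
      rw [model, map_sum]; exact Finset.sum_congr rfl fun i _ => map_mul _ _ _]
    rw [Finset.mul_sum]
    exact Finset.sum_congr rfl fun i _ => by ring
  simp_rw [h2]
  rw [Finset.sum_comm]
  have h3 : ∀ i ∈ S, ∑ k, conj (a i) * (conj (φ i k) * model φ S a k) = conj (a i) * (c * a i) := by
    intro i hi
    rw [← Finset.mul_sum, sum_conj_mul_model hφ S a i, if_pos hi]
  rw [Finset.sum_congr rfl h3, Complex.re_sum, Finset.mul_sum]
  refine Finset.sum_congr rfl fun i _ => ?_
  have : conj (a i) * (c * a i) = c * (a i * conj (a i)) := by ring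
  rw [this, Complex.mul_conj, Complex.re_mul_ofReal, Complex.normSq_eq_norm_sq]

/-- **Least-squares Pythagoras for an orthogonal family**: for every coefficient vector `a`,
`lsq φ S f a = lsq φ S f (coeff φ c f) + Re c · Σ_{i ∈ S} ‖a i − coeff φ c f i‖²`
(`c ≠ 0`; for characters `c = L^d` is real and positive). [cite: HammerlinHoffman1991, Ch. 6 §6.1 (Normal Equations) and §6.5] -/
theorem lsq_eq_lsq_coeff_add (hφ : ∀ i j, ∑ k, φ i k * conj (φ j k) = if i = j then c else 0) (hc : c ≠ 0) (S : Finset ι) (f : κ → ℂ) (a : ι → ℂ) :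
    lsq φ S f a = lsq φ S f (coeff φ c f) + c.re * ∑ i ∈ S, ‖a i - coeff φ c f i‖ ^ 2 := by
  classical
  set w := coeff φ c f with hw
  -- residual r k := f k − model w k ; correction δ k := model (a − w) k ; f − model a = r − δ
  have hsplit : ∀ k, f k - model φ S a k = (f k - model φ S w k) - model φ S (fun i => a i - w i) k := by
    intro k
    rw [model_sub]
    ring
  have hcross : ∑ k, ((f k - model φ S w k) * conj (model φ S (fun i => a i - w i) k)).re = 0 := by
    rw [← Complex.re_sum]
    have h1 : ∀ k, (f k - model φ S w k) * conj (model φ S (fun i => a i - w i) k)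
        = ∑ i ∈ S, conj (a i - w i) * ((f k - model φ S w k) * conj (φ i k)) := by
      intro k
      rw [show conj (model φ S (fun i => a i - w i) k) = ∑ i ∈ S, conj (a i - w i) * conj (φ i k) by
        rw [model, map_sum]; exact Finset.sum_congr rfl fun i _ => map_mul _ _ _]
      rw [Finset.mul_sum]
      exact Finset.sum_congr rfl fun i _ => by ring
    simp_rw [h1]
    rw [Finset.sum_comm]
    have h2 : ∀ i ∈ S, ∑ k, conj (a i - w i) * ((f k - model φ S w k) * conj (φ i k)) = 0 := by
      intro i hi
      rw [← Finset.mul_sum, hw, sum_residual_mul_conj_eq_zero hφ hc S f hi, mul_zero]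
    rw [Finset.sum_congr rfl h2, Finset.sum_const_zero, Complex.zero_re]
  unfold lsq
  simp_rw [hsplit]
  have h3 : ∀ k, ‖(f k - model φ S w k) - model φ S (fun i => a i - w i) k‖ ^ 2
      = ‖f k - model φ S w k‖ ^ 2 + ‖model φ S (fun i => a i - w i) k‖ ^ 2
        - 2 * ((f k - model φ S w k) * conj (model φ S (fun i => a i - w i) k)).re := by
    intro k
    rw [← Complex.normSq_eq_norm_sq, ← Complex.normSq_eq_norm_sq, ← Complex.normSq_eq_norm_sq, Complex.normSq_sub]
  simp_rw [h3]
  rw [Finset.sum_sub_distrib, Finset.sum_add_distrib, ← Finset.mul_sum, hcross, mul_zero, sub_zero,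
    lsq_model hφ S (fun i => a i - w i)]

/-- Consequence: the projection coefficients MINIMISE the least-squares functional (`0 ≤ Re c`). [cite: HammerlinHoffman1991, Ch. 6 §6.1 (Normal Equations) and §6.5] -/
theorem lsq_coeff_le (hφ : ∀ i j, ∑ k, φ i k * conj (φ j k) = if i = j then c else 0) (hc : c ≠ 0) (hc' : 0 ≤ c.re) (S : Finset ι) (f : κ → ℂ)
    (a : ι → ℂ) : lsq φ S f (coeff φ c f) ≤ lsq φ S f a := by
  rw [lsq_eq_lsq_coeff_add hφ hc S f a]
  have : 0 ≤ c.re * ∑ i ∈ S, ‖a i - coeff φ c f i‖ ^ 2 :=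
    mul_nonneg hc' (Finset.sum_nonneg fun i _ => by positivity)
  linarith

/-- … and they are the ONLY minimiser on `S` when `0 < Re c`: any `a` doing at least as well agrees with `coeff` on `S`.
[cite: HammerlinHoffman1991, Ch. 6 §6.2 (unique solution of the normal equations) and §6.5] -/
theorem eq_coeff_of_lsq_le (hφ : ∀ i j, ∑ k, φ i k * conj (φ j k) = if i = j then c else 0) (hc : 0 < c.re) (S : Finset ι) (f : κ → ℂ) (a : ι → ℂ)
    (ha : lsq φ S f a ≤ lsq φ S f (coeff φ c f)) {i : ι} (hi : i ∈ S) : a i = coeff φ c f i := by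
  have hc0 : c ≠ 0 := fun h => by rw [h, Complex.zero_re] at hc; exact lt_irrefl _ hc
  have hid := lsq_eq_lsq_coeff_add hφ hc0 S f a
  have hsum0 : ∑ j ∈ S, ‖a j - coeff φ c f j‖ ^ 2 = 0 := by
    have hnn : 0 ≤ ∑ j ∈ S, ‖a j - coeff φ c f j‖ ^ 2 := Finset.sum_nonneg fun j _ => by positivity
    have hle : c.re * ∑ j ∈ S, ‖a j - coeff φ c f j‖ ^ 2 ≤ 0 := by linarith
    rcases hnn.lt_or_eq with hlt | heq
    · exact absurd hle (not_le.mpr (mul_pos hc hlt))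
    · exact heq.symm
  have hterm : ‖a i - coeff φ c f i‖ ^ 2 = 0 :=
    (Finset.sum_eq_zero_iff_of_nonneg fun j _ => by positivity).1 hsum0 i hi
  have : ‖a i - coeff φ c f i‖ = 0 := by
    rcases (sq_eq_zero_iff.mp hterm) with h
    exact h
  exact sub_eq_zero.mp (norm_eq_zero.mp this)

/-- Exact recovery: if `f` IS a model with coefficients `a₀` on `S₀`, its projection coefficients are `a₀` on `S₀` and `0`
outside (`c ≠ 0`). [cite: HammerlinHoffman1991, Ch. 6 §6.5 (n = N: the fit interpolates)] -/
theorem coeff_model (hφ : ∀ i j, ∑ k, φ i k * conj (φ j k) = if i = j then c else 0) (hc : c ≠ 0) (S₀ : Finset ι) (a₀ : ι → ℂ) (i : ι) :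
    coeff φ c (model φ S₀ a₀) i = if i ∈ S₀ then a₀ i else 0 := by
  rw [coeff]
  have h1 : ∑ k, model φ S₀ a₀ k * conj (φ i k) = ∑ k, conj (φ i k) * model φ S₀ a₀ k :=
    Finset.sum_congr rfl fun k _ => mul_comm _ _
  rw [h1, sum_conj_mul_model hφ S₀ a₀ i]
  split_ifs with hi
  · rw [mul_div_cancel_left₀ _ hc]
  · rw [zero_div]

end Abstract

/-! ### The torus characters as regressors: Wannier hoppings versus full-grid fits -/

section Torus

variable {d L : ℕ} [NeZero L]

/- Orthogonality of the hopping regressors `χ_R(k)` over the full `k`-grid, `Σ_k χ_R(k) conj χ_{R'}(k) = L^d [R = R']`,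
is the tree's `Literature.Probability.LatticeModels.TorusBlock.sum_torusChar_mul_conj` (TorusBlockFourier.lean) — reused, not restated. -/

omit [NeZero L] in
/-- `Re (L^d : ℂ) = L^d`. [folklore] -/
private theorem re_natCast_pow : (((L : ℂ) ^ d).re : ℝ) = (L : ℝ) ^ d := by
  rw [← Complex.ofReal_natCast, ← Complex.ofReal_pow, Complex.ofReal_re]

/-- `0 < Re (L^d : ℂ)`. [folklore] -/
private theorem re_natCast_pow_pos : 0 < ((L : ℂ) ^ d).re := by
  rw [re_natCast_pow]
  exact pow_pos (Nat.cast_pos.mpr (Nat.pos_of_ne_zero (NeZero.ne L))) d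

/-- The truncated tight-binding band `ε_S[t](k) = Σ_{R ∈ S} t(R) χ_R(k)` with hoppings `t` on the hopping-vector set `S`
(for a Hermitian real band one takes `S = −S`, `t(−R) = conj t(R)`; the cosine form `−2t(cos kₓ + cos k_y) − 4t′ cos kₓ cos k_y
− …` of [PavariniEtAl2001, Eq. (1)] is the case `d = 2`, `S` = the star of the first few neighbours).
[cite: PavariniEtAl2001, Eq. (1)] -/
def tbBand (S : Finset (TorusSite d L)) (t : TorusSite d L → ℂ) (k : TorusSite d L) : ℂ :=
  model (fun (R k : TorusSite d L) => torusChar R k) S t k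

/-- `tbBand` unfolded. [cite: PavariniEtAl2001, Eq. (1)] -/
theorem tbBand_eq (S : Finset (TorusSite d L)) (t : TorusSite d L → ℂ) (k : TorusSite d L) :
    tbBand S t k = ∑ R ∈ S, t R * torusChar R k := rfl

/-- The WANNIER (Fourier) hopping of a band on the full grid: `t_W[ε](R) = L^{-d} Σ_k ε(k) conj χ_R(k)` — the lattice Fourier
coefficient of the band energy in its own Bloch gauge [MarzariEtAl2012, §II.A (3)–(4)] (object M of the cell).
[cite: MarzariEtAl2012, §II.A eq. (3)-(4)] -/
def fourierHopping (ε : TorusSite d L → ℂ) (R : TorusSite d L) : ℂ :=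
  coeff (fun (R k : TorusSite d L) => torusChar R k) ((L : ℂ) ^ d) ε R

/-- `fourierHopping` unfolded. [cite: MarzariEtAl2012, §II.A eq. (3)-(4)] -/
theorem fourierHopping_eq (ε : TorusSite d L → ℂ) (R : TorusSite d L) :
    fourierHopping ε R = (∑ k, ε k * conj (torusChar R k)) / (L : ℂ) ^ d := rfl

/-- The FULL-GRID least-squares residual of a tight-binding fit truncated to `S`:
`Σ_k ‖ε(k) − Σ_{R ∈ S} t(R) χ_R(k)‖²` (object E with the window = the whole zone) [MarkiewiczEtAl2005, §II].
[cite: MarkiewiczEtAl2005, §II] -/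
def residual (ε : TorusSite d L → ℂ) (S : Finset (TorusSite d L)) (t : TorusSite d L → ℂ) : ℝ :=
  lsq (fun (R k : TorusSite d L) => torusChar R k) S ε t

/-- `residual` unfolded. [cite: MarkiewiczEtAl2005, §II] -/
theorem residual_eq (ε : TorusSite d L → ℂ) (S : Finset (TorusSite d L)) (t : TorusSite d L → ℂ) :
    residual ε S t = ∑ k, ‖ε k - tbBand S t k‖ ^ 2 := rfl

/-- The WINDOWED residual `Σ_{k ∈ W} ‖ε(k) − ε_S[t](k)‖²` of a fit restricted to a `k`-window `W` (the printed E objects: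
«|ε − E*| ≤ w» windows).  No orthogonality survives the restriction; its minimiser depends on BOTH `W` and `S` — recorded as a
definition only, the dependence being the located INFL-TRUNC spread. [cite: MarkiewiczEtAl2005, §II] -/
def windowResidual (W : Finset (TorusSite d L)) (ε : TorusSite d L → ℂ) (S : Finset (TorusSite d L))
    (t : TorusSite d L → ℂ) : ℝ :=
  ∑ k ∈ W, ‖ε k - tbBand S t k‖ ^ 2

/-- The full window is the full-grid residual. [cite: MarkiewiczEtAl2005, §II] -/
theorem windowResidual_univ (ε : TorusSite d L → ℂ) (S : Finset (TorusSite d L)) (t : TorusSite d L → ℂ) :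
    windowResidual Finset.univ ε S t = residual ε S t := rfl

/-- **Pythagoras for tight-binding fits on the full grid**: for every truncation set `S` and every hopping vector `t`,
`residual ε S t = residual ε S (fourierHopping ε) + L^d · Σ_{R ∈ S} ‖t R − fourierHopping ε R‖²`. [cite: HammerlinHoffman1991, Ch. 6 §6.1 (Normal Equations) and §6.5] -/
theorem residual_eq_residual_fourier_add (ε : TorusSite d L → ℂ) (S : Finset (TorusSite d L))
    (t : TorusSite d L → ℂ) :
    residual ε S t = residual ε S (fourierHopping ε) + (L : ℝ) ^ d * ∑ R ∈ S, ‖t R - fourierHopping ε R‖ ^ 2 := by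
  have h := lsq_eq_lsq_coeff_add (φ := fun (R k : TorusSite d L) => torusChar R k) TorusBlock.sum_torusChar_mul_conj natCast_pow_ne_zero S ε t
  rw [re_natCast_pow] at h
  exact h

/-- **The Wannier hoppings minimise every full-grid truncated fit**: `residual ε S (fourierHopping ε) ≤ residual ε S t`
for all `t` and ALL truncation sets `S`. [cite: HammerlinHoffman1991, Ch. 6 §6.5 (Orthogonality Relation; α̃_k = ⟨y, g_k⟩/‖g_k‖²)] -/
theorem residual_fourier_le (ε : TorusSite d L → ℂ) (S : Finset (TorusSite d L)) (t : TorusSite d L → ℂ) :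
    residual ε S (fourierHopping ε) ≤ residual ε S t :=
  lsq_coeff_le TorusBlock.sum_torusChar_mul_conj natCast_pow_ne_zero (le_of_lt re_natCast_pow_pos) S ε t

/-- **… and uniquely**: a hopping vector that fits at least as well as the Wannier hoppings on the full grid EQUALS them on
`S` — independently of which other hopping vectors `S` contains («truncating the fitted range on the full `k`-grid does
not bias the fitted hoppings: E = M there»). [cite: HammerlinHoffman1991, Ch. 6 §6.2 and §6.5] -/
theorem eq_fourierHopping_of_residual_le (ε : TorusSite d L → ℂ) (S : Finset (TorusSite d L))
    (t : TorusSite d L → ℂ) (ht : residual ε S t ≤ residual ε S (fourierHopping ε)) {R : TorusSite d L}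
    (hR : R ∈ S) : t R = fourierHopping ε R :=
  eq_coeff_of_lsq_le TorusBlock.sum_torusChar_mul_conj re_natCast_pow_pos S ε t ht hR

/-- **Range-independence of the full-grid fit**, stated for two truncation sets at once: the minimisers over `S₁` and over
`S₂` agree on `S₁ ∩ S₂` (both equal the Wannier hoppings there). [cite: HammerlinHoffman1991, Ch. 6 §6.5] -/
theorem minimisers_agree_on_inter (ε : TorusSite d L → ℂ) {S₁ S₂ : Finset (TorusSite d L)}
    {t₁ t₂ : TorusSite d L → ℂ} (h₁ : ∀ t, residual ε S₁ t₁ ≤ residual ε S₁ t)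
    (h₂ : ∀ t, residual ε S₂ t₂ ≤ residual ε S₂ t) {R : TorusSite d L} (hR : R ∈ S₁ ∩ S₂) : t₁ R = t₂ R := by
  rw [Finset.mem_inter] at hR
  rw [eq_fourierHopping_of_residual_le ε S₁ t₁ (h₁ _) hR.1, eq_fourierHopping_of_residual_le ε S₂ t₂ (h₂ _) hR.2]

/-- **Exact recovery / no aliasing on the full grid**: the Wannier hoppings of a tight-binding band `ε_{S₀}[t₀]` are `t₀`
on `S₀` and `0` outside. [cite: HammerlinHoffman1991, Ch. 6 §6.5 (n = N: the fit interpolates)] -/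
theorem fourierHopping_tbBand (S₀ : Finset (TorusSite d L)) (t₀ : TorusSite d L → ℂ) (R : TorusSite d L) :
    fourierHopping (tbBand S₀ t₀) R = if R ∈ S₀ then t₀ R else 0 :=
  coeff_model TorusBlock.sum_torusChar_mul_conj natCast_pow_ne_zero S₀ t₀ R

/-- Corollary: fitting a tight-binding band `ε_{S₀}[t₀]` on the full grid with ANY truncation set `S` (larger, smaller or
overlapping) recovers `t₀` exactly on `S ∩ S₀` and gives `0` on `S \ S₀` at the optimum. [cite: HammerlinHoffman1991, Ch. 6 §6.5] -/
theorem fit_of_tbBand (S₀ S : Finset (TorusSite d L)) (t₀ t : TorusSite d L → ℂ)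
    (ht : ∀ t', residual (tbBand S₀ t₀) S t ≤ residual (tbBand S₀ t₀) S t') {R : TorusSite d L} (hR : R ∈ S) :
    t R = if R ∈ S₀ then t₀ R else 0 := by
  rw [eq_fourierHopping_of_residual_le _ S t (ht _) hR, fourierHopping_tbBand]

/-! ### The truncation tail (Parseval): what truncating the hopping set does to the BAND

The hoppings retained by a full-grid fit do not move under truncation (above); what truncation changes is the band itself,
and by exactly the ℓ²-mass of the dropped hoppings — the discrete Parseval identity of [HammerlinHoffman1991, Ch. 6 §6.5]
applied to the tail `S₀ \ S` (per `k`-point: mean-square band error `= Σ_{R ∈ S₀ \ S} ‖t₀ R‖²`). -/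

/-- Fitting over `S` with the zero-extended coefficients of `S₀` is the model over `S ∩ S₀`.
[cite: HammerlinHoffman1991, Ch. 6 §6.5] -/
theorem tbBand_ite_mem (S S₀ : Finset (TorusSite d L)) (t₀ : TorusSite d L → ℂ) (k : TorusSite d L) :
    tbBand S (fun R => if R ∈ S₀ then t₀ R else 0) k = tbBand (S ∩ S₀) t₀ k := by
  classical
  simp_rw [tbBand_eq, ite_mul, zero_mul, Finset.sum_ite_mem]

/-- Splitting a tight-binding band over `S₀` into its part on `S` and its TAIL outside `S`:
`ε_{S₀ \ S}[t₀] + ε_{S ∩ S₀}[t₀] = ε_{S₀}[t₀]`. [cite: PavariniEtAl2001, Eq. (1)] -/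
theorem tbBand_sdiff_add_tbBand_inter (S S₀ : Finset (TorusSite d L)) (t₀ : TorusSite d L → ℂ) (k : TorusSite d L) :
    tbBand (S₀ \ S) t₀ k + tbBand (S ∩ S₀) t₀ k = tbBand S₀ t₀ k := by
  classical
  rw [tbBand_eq, tbBand_eq, tbBand_eq, ← Finset.sdiff_inter_self_right S₀ S]
  exact Finset.sum_sdiff Finset.inter_subset_right

/-- On the full grid, the band error of the optimal (= Wannier) fit of `ε_{S₀}[t₀]` truncated to `S` IS the tail band:
`ε_{S₀}[t₀](k) − ε_S[t_W](k) = ε_{S₀ \ S}[t₀](k)` at every `k`. [cite: HammerlinHoffman1991, Ch. 6 §6.5] -/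
theorem tbBand_sub_fit_eq_tail (S₀ S : Finset (TorusSite d L)) (t₀ : TorusSite d L → ℂ) (k : TorusSite d L) :
    tbBand S₀ t₀ k - tbBand S (fourierHopping (tbBand S₀ t₀)) k = tbBand (S₀ \ S) t₀ k := by
  have h : fourierHopping (tbBand S₀ t₀) = fun R => if R ∈ S₀ then t₀ R else 0 :=
    funext (fourierHopping_tbBand S₀ t₀)
  rw [h, tbBand_ite_mem, ← tbBand_sdiff_add_tbBand_inter S S₀ t₀ k, add_sub_cancel_right]

/-- **Truncation tail (Parseval)**: on the full `L^d` grid the least residual of fitting the tight-binding band `ε_{S₀}[t₀]`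
with the truncated hopping set `S` — attained at the Wannier hoppings — equals `L^d · Σ_{R ∈ S₀ \ S} ‖t₀ R‖²` EXACTLY: the
per-`k` mean-square band error of dropping shells is the ℓ²-mass of the dropped hoppings and nothing else.
[cite: HammerlinHoffman1991, Ch. 6 §6.5 (Parseval / Bessel for the discrete orthogonal system)] -/
theorem residual_fourier_tbBand (S₀ S : Finset (TorusSite d L)) (t₀ : TorusSite d L → ℂ) :
    residual (tbBand S₀ t₀) S (fourierHopping (tbBand S₀ t₀)) = (L : ℝ) ^ d * ∑ R ∈ S₀ \ S, ‖t₀ R‖ ^ 2 := by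
  rw [residual_eq]
  simp_rw [tbBand_sub_fit_eq_tail]
  have h := lsq_model TorusBlock.sum_torusChar_mul_conj (S₀ \ S) t₀
  rw [re_natCast_pow] at h
  exact h

/-- Corollary: for ANY hoppings `t` on `S`, the full-grid residual against a tight-binding band splits into the truncation
tail plus `L^d` times the coefficient mismatch on `S`:
`residual = L^d Σ_{R ∈ S₀ \ S} ‖t₀ R‖² + L^d Σ_{R ∈ S} ‖t R − [R ∈ S₀] t₀ R‖²`. [cite: HammerlinHoffman1991, Ch. 6 §6.5] -/
theorem residual_tbBand_eq_tail_add (S₀ S : Finset (TorusSite d L)) (t₀ t : TorusSite d L → ℂ) :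
    residual (tbBand S₀ t₀) S t = (L : ℝ) ^ d * ∑ R ∈ S₀ \ S, ‖t₀ R‖ ^ 2
      + (L : ℝ) ^ d * ∑ R ∈ S, ‖t R - (if R ∈ S₀ then t₀ R else 0)‖ ^ 2 := by
  rw [residual_eq_residual_fourier_add, residual_fourier_tbBand]
  congr 2
  refine Finset.sum_congr rfl fun R _ => ?_
  rw [fourierHopping_tbBand]

/-- The tail is MONOTONE in the truncation: enlarging the retained set `S ⊆ S'` can only lower the optimal full-grid residual.
[cite: HammerlinHoffman1991, Ch. 6 §6.5] -/
theorem residual_fourier_tbBand_anti {S S' : Finset (TorusSite d L)} (hSS' : S ⊆ S') (S₀ : Finset (TorusSite d L))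
    (t₀ : TorusSite d L → ℂ) :
    residual (tbBand S₀ t₀) S' (fourierHopping (tbBand S₀ t₀)) ≤ residual (tbBand S₀ t₀) S (fourierHopping (tbBand S₀ t₀)) := by
  rw [residual_fourier_tbBand, residual_fourier_tbBand]
  refine mul_le_mul_of_nonneg_left ?_ (pow_nonneg (Nat.cast_nonneg L) d)
  exact Finset.sum_le_sum_of_subset_of_nonneg (Finset.sdiff_subset_sdiff (Finset.Subset.refl S₀) hSS')
    fun R _ _ => pow_nonneg (norm_nonneg _) 2

/-- And it VANISHES once `S ⊇ S₀` (nothing dropped): the full-grid fit then reproduces the band exactly.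
[cite: HammerlinHoffman1991, Ch. 6 §6.5 (n = N: interpolation)] -/
theorem residual_fourier_tbBand_of_subset {S₀ S : Finset (TorusSite d L)} (h : S₀ ⊆ S) (t₀ : TorusSite d L → ℂ) :
    residual (tbBand S₀ t₀) S (fourierHopping (tbBand S₀ t₀)) = 0 := by
  rw [residual_fourier_tbBand, Finset.sdiff_eq_empty_iff_subset.mpr h, Finset.sum_empty, mul_zero]

/-! ### Window fits act only through the truncation tail

A fit restricted to a `k`-window `W` has no orthogonality and no closed form (`windowResidual` is only DEFINED above).  Two
exact statements nevertheless hold: at the zero-extended true hoppings the window residual is the window's view of the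
TAIL band and nothing else; and if nothing is truncated (`S₀ ⊆ S`) every window fit whose truncated design separates
hopping vectors on `W` (unique solvability of the windowed normal equations, [HammerlinHoffman1991, Ch. 6 §6.2]) returns
the true hoppings exactly.  So the window lever on the fitted hoppings needs a non-zero truncation tail to act on: the
E–M spread is a joint window × tail effect, zero if either the window is the full grid (above) or the tail vanishes. -/

/-- At the zero-extended true hoppings, the window residual of fitting `ε_{S₀}[t₀]` with the set `S` is the window's
view of the tail band: `Σ_{k ∈ W} ‖ε_{S₀ \ S}[t₀](k)‖²`. [cite: HammerlinHoffman1991, Ch. 6 §6.5] -/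
theorem windowResidual_tbBand_ite_mem (W S₀ S : Finset (TorusSite d L)) (t₀ : TorusSite d L → ℂ) :
    windowResidual W (tbBand S₀ t₀) S (fun R => if R ∈ S₀ then t₀ R else 0)
      = ∑ k ∈ W, ‖tbBand (S₀ \ S) t₀ k‖ ^ 2 := by
  refine Finset.sum_congr rfl fun k _ => ?_
  rw [tbBand_ite_mem, ← tbBand_sdiff_add_tbBand_inter S S₀ t₀ k, add_sub_cancel_right]

/-- With nothing truncated (`S₀ ⊆ S`) the zero-extended true hoppings make EVERY window residual vanish.
[cite: HammerlinHoffman1991, Ch. 6 §6.5 (n = N: interpolation)] -/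
theorem windowResidual_tbBand_eq_zero (W : Finset (TorusSite d L)) {S₀ S : Finset (TorusSite d L)} (h : S₀ ⊆ S)
    (t₀ : TorusSite d L → ℂ) :
    windowResidual W (tbBand S₀ t₀) S (fun R => if R ∈ S₀ then t₀ R else 0) = 0 := by
  rw [windowResidual_tbBand_ite_mem, Finset.sdiff_eq_empty_iff_subset.mpr h]
  refine Finset.sum_eq_zero fun k _ => ?_
  rw [tbBand_eq, Finset.sum_empty, norm_zero, zero_pow two_ne_zero]

/-- **Window fits act only through the tail.**  If the band is a tight-binding band supported INSIDE the fitted set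
(`S₀ ⊆ S`) and the truncated design separates hopping vectors on the window `W` (`hsep`: two hopping vectors on `S` with
the same band values on `W` agree on `S` — unique solvability of the windowed least-squares problem), then ANY minimiser
of the window residual is the true hopping vector, zero-extended: a `k`-window moves the fitted hoppings only when
something outside `S` was dropped. [cite: HammerlinHoffman1991, Ch. 6 §6.2 (unique solvability) and §6.5] -/
theorem windowFit_of_tbBand (W : Finset (TorusSite d L)) {S₀ S : Finset (TorusSite d L)} (h : S₀ ⊆ S)
    (hsep : ∀ a b : TorusSite d L → ℂ, (∀ k ∈ W, tbBand S a k = tbBand S b k) → ∀ R ∈ S, a R = b R)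
    (t₀ t : TorusSite d L → ℂ)
    (ht : ∀ t', windowResidual W (tbBand S₀ t₀) S t ≤ windowResidual W (tbBand S₀ t₀) S t')
    {R : TorusSite d L} (hR : R ∈ S) : t R = if R ∈ S₀ then t₀ R else 0 := by
  have h0 : windowResidual W (tbBand S₀ t₀) S t = 0 :=
    le_antisymm ((ht _).trans_eq (windowResidual_tbBand_eq_zero W h t₀))
      (Finset.sum_nonneg fun k _ => pow_nonneg (norm_nonneg _) 2)
  have hk : ∀ k ∈ W, tbBand S (fun R => if R ∈ S₀ then t₀ R else 0) k = tbBand S t k := by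
    intro k hk
    have hz := (Finset.sum_eq_zero_iff_of_nonneg fun k _ => pow_nonneg (norm_nonneg _) 2).mp h0 k hk
    rw [pow_eq_zero_iff two_ne_zero, norm_eq_zero, sub_eq_zero] at hz
    rw [tbBand_ite_mem, Finset.inter_eq_right.mpr h]
    exact hz
  exact (hsep _ _ hk R hR).symm

/-- On the FULL window the separation hypothesis of `windowFit_of_tbBand` holds for every `S` (orthogonality), so the
statement there contains the full-grid exact recovery `fit_of_tbBand` restricted to `S₀ ⊆ S` as the case `W = univ`.
[cite: HammerlinHoffman1991, Ch. 6 §6.5] -/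
theorem tbBand_separates_univ (S : Finset (TorusSite d L)) (a b : TorusSite d L → ℂ)
    (hab : ∀ k ∈ (Finset.univ : Finset (TorusSite d L)), tbBand S a k = tbBand S b k) {R : TorusSite d L} (hR : R ∈ S) :
    a R = b R := by
  have ha := fourierHopping_tbBand S a R
  have hb := fourierHopping_tbBand S b R
  rw [if_pos hR] at ha hb
  have hfun : tbBand S a = tbBand S b := funext fun k => hab k (Finset.mem_univ k)
  rw [← ha, ← hb, hfun]

/-! ### Mesh aliasing: a coarse `k`-mesh folds the hopping set onto `(ℤ/L)^d`

On the `L^d` mesh the regressor of an INTEGER hopping vector `v ∈ ℤ^d` is the character of its reduction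
`v̄ = Torus.proj L v`; vectors with the same reduction are the same regressor, so the Wannier/Fourier hopping the mesh
returns at a class `R` is the ALIAS SUM `Σ_{v ∈ T, v̄ = R} t(v)` — Cantrell's alias mapping «γ_m = N Σ_n g_{m+nN}»
[Cantrell2000, §8.5.5 Eq. (8.363)] in `d` dimensions for a finitely supported hopping set.  (The summable,
infinite-support version — periodisation / discrete Poisson summation — is the tree's
`Literature.Probability.LatticeModels.torusFourierInv_latticeFourierTorus_eq_tsum_translate`
(DiscretePoissonSummation.lean) and is not restated here.)  Example: on a 4-point in-plane mesh the `(2,0)` and `(−2,0)`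
hoppings of a `t–t′–t″` band are ONE class with coefficient `2t″` (wannier90 prints it on both Wigner–Seitz-boundary
copies with `ndegen = 2`); an `8`-point mesh separates them. -/

/-- A tight-binding band with hoppings `t` on a finite set `T ⊂ ℤ^d` of integer hopping vectors, SAMPLED on the `L^d`
mesh: `Σ_{v ∈ T} t(v) χ_{v̄}(k)`. [cite: MarzariEtAl2012, §II.A eq. (3)-(4)] -/
def latticeBand (T : Finset (Site d)) (t : Site d → ℂ) (k : TorusSite d L) : ℂ :=
  ∑ v ∈ T, t v * torusChar (Torus.proj L v) k

/-- The ALIAS SUM of the hoppings over the mesh class `R`: `Σ_{v ∈ T, v̄ = R} t(v)`.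
[cite: Cantrell2000, §8.5.5 Eq. (8.363)] -/
def aliasSum (L : ℕ) (T : Finset (Site d)) (t : Site d → ℂ) (R : TorusSite d L) : ℂ :=
  ∑ v ∈ T with Torus.proj L v = R, t v

/-- Regrouping by mesh classes: the sampled lattice band IS the torus tight-binding band of the alias sums on the image
classes. [cite: Cantrell2000, §8.5.5 Eq. (8.361)-(8.363)] -/
theorem latticeBand_eq_tbBand (T : Finset (Site d)) (t : Site d → ℂ) (k : TorusSite d L) :
    latticeBand T t k = tbBand (T.image (Torus.proj L)) (aliasSum L T t) k := by
  classical
  rw [latticeBand, tbBand_eq]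
  have h : ∀ R ∈ T.image (Torus.proj L), aliasSum L T t R * torusChar R k
      = ∑ v ∈ T with Torus.proj L v = R, t v * torusChar (Torus.proj L v) k := by
    intro R _
    rw [aliasSum, Finset.sum_mul]
    refine Finset.sum_congr rfl fun v hv => ?_
    rw [(Finset.mem_filter.mp hv).2]
  rw [Finset.sum_congr rfl h]
  exact (Finset.sum_fiberwise_of_maps_to (fun v hv => Finset.mem_image_of_mem (Torus.proj L) hv) _).symm

/-- **Mesh aliasing**: the Wannier/Fourier hopping that the `L^d` mesh assigns to the class `R` is the alias sum of the
true hoppings reducing to `R` (and `0` at classes no hopping vector reduces to). [cite: Cantrell2000, §8.5.5 Eq. (8.363)] -/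
theorem fourierHopping_latticeBand (T : Finset (Site d)) (t : Site d → ℂ) (R : TorusSite d L) :
    fourierHopping (latticeBand T t) R = aliasSum L T t R := by
  classical
  have h : (latticeBand T t : TorusSite d L → ℂ) = tbBand (T.image (Torus.proj L)) (aliasSum L T t) :=
    funext (latticeBand_eq_tbBand T t)
  rw [h, fourierHopping_tbBand]
  split_ifs with hR
  · rfl
  · have he : T.filter (fun v => Torus.proj L v = R) = ∅ :=
      Finset.filter_eq_empty_iff.mpr fun v (hv : v ∈ T) (hvR : Torus.proj L v = R) =>
        hR (hvR ▸ Finset.mem_image_of_mem (Torus.proj L) hv)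
    rw [aliasSum, he, Finset.sum_empty]

/-- NO aliasing when the mesh separates the hopping set: if the reduction `Torus.proj L` is injective on `T`, the mesh
returns exactly `t(v)` at `v̄` for every `v ∈ T` (the sampling-theorem side of the alias mapping).
[cite: Cantrell2000, §8.5.5] -/
theorem fourierHopping_latticeBand_of_injOn (T : Finset (Site d)) (t : Site d → ℂ)
    (hinj : Set.InjOn (Torus.proj L) (T : Set (Site d))) {v : Site d} (hv : v ∈ T) :
    fourierHopping (latticeBand T t) (Torus.proj L v) = t v := by
  classical
  rw [fourierHopping_latticeBand, aliasSum]
  have h : T.filter (fun w => Torus.proj L w = Torus.proj L v) = {v} := by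
    ext w
    simp only [Finset.mem_filter, Finset.mem_singleton]
    constructor
    · rintro ⟨hw, hwv⟩
      exact hinj hw hv hwv
    · rintro rfl
      exact ⟨hv, rfl⟩
  rw [h, Finset.sum_singleton]

/-- The two-fold alias: two distinct hopping vectors with the same reduction and no other class-mates contribute their
SUM — the `(2,0)`/`(−2,0)` pair of a `t–t′–t″` band on a 4-point mesh gives the class coefficient `t″ + t″ = 2t″`.
[cite: Cantrell2000, §8.5.5 Eq. (8.363)] -/
theorem fourierHopping_latticeBand_pair (T : Finset (Site d)) (t : Site d → ℂ) {v w : Site d} (hv : v ∈ T)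
    (hw : w ∈ T) (hvw : v ≠ w) (hpw : Torus.proj L w = Torus.proj L v)
    (honly : ∀ u ∈ T, Torus.proj L u = Torus.proj L v → u = v ∨ u = w) :
    fourierHopping (latticeBand T t) (Torus.proj L v) = t v + t w := by
  classical
  rw [fourierHopping_latticeBand, aliasSum]
  have h : T.filter (fun u => Torus.proj L u = Torus.proj L v) = {v, w} := by
    ext u
    simp only [Finset.mem_filter, Finset.mem_insert, Finset.mem_singleton]
    constructor
    · rintro ⟨hu, huv⟩
      exact honly u hu huv
    · rintro (rfl | rfl)
      exacts [⟨hv, rfl⟩, ⟨hw, hpw⟩]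
  rw [h, Finset.sum_pair hvw]

end Torus

/-! ### Cosine harmonics: the real tight-binding form `Σ_R 2 t_R cos(2π k·R/L)` -/

section Cosine

variable {d L : ℕ} [NeZero L]

/-- The cosine regressor of the hopping vector `R`: `c_R(k) = χ_R(k) + χ_{−R}(k)` (`= 2 cos(2π k·R/L)`), the harmonic that
multiplies a real symmetric hopping `t(R) = t(−R)` in the printed one-band forms [PavariniEtAl2001, Eq. (1)].
[cite: PavariniEtAl2001, Eq. (1)] -/
def cosChar (R k : TorusSite d L) : ℂ :=
  torusChar R k + torusChar (-R) k

/-- Orthogonality of the cosine regressors on a set of hopping REPRESENTATIVES `S` containing no pair `R, R'` with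
`R = −R'` (one vector per `±` pair, and no self-conjugate vector `2R = 0`):
`Σ_k c_R(k) conj c_{R'}(k) = 2 L^d [R = R']` for `R, R' ∈ S`. [cite: HammerlinHoffman1991, Ch. 6 §6.5 (Orthogonality Relation in ℝ^N)] -/
theorem sum_cosChar_mul_conj {S : Finset (TorusSite d L)} (hS : ∀ R ∈ S, ∀ R' ∈ S, R ≠ -R') {R R' : TorusSite d L}
    (hR : R ∈ S) (hR' : R' ∈ S) :
    ∑ k, cosChar R k * conj (cosChar R' k) = if R = R' then 2 * (L : ℂ) ^ d else 0 := by
  have hne : R ≠ -R' := hS R hR R' hR'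
  have hne' : -R ≠ R' := fun h => hne (by rw [← h, neg_neg])
  have h1 : ∀ k : TorusSite d L, cosChar R k * conj (cosChar R' k)
      = torusChar R k * conj (torusChar R' k) + torusChar R k * conj (torusChar (-R') k)
        + torusChar (-R) k * conj (torusChar R' k) + torusChar (-R) k * conj (torusChar (-R') k) := by
    intro k
    simp only [cosChar, map_add]
    ring
  simp_rw [h1, Finset.sum_add_distrib, TorusBlock.sum_torusChar_mul_conj]
  rw [if_neg hne, if_neg hne']
  by_cases h : R = R'
  · subst h
    simp
    ring
  · have h' : -R ≠ -R' := fun hh => h (neg_injective hh)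
    rw [if_neg h, if_neg h']
    simp [h]

/-- The restriction of the cosine family to `S` as a regressor family indexed by the subtype `S` (non-Prop plumbing). [folklore] -/
def cosFamily (S : Finset (TorusSite d L)) (R : S) (k : TorusSite d L) : ℂ :=
  cosChar (R : TorusSite d L) k

/-- The cosine family on representatives is an orthogonal family with common squared norm `2L^d`. [cite: HammerlinHoffman1991, Ch. 6 §6.5 (Orthogonality Relation in ℝ^N)] -/
theorem cosFamily_orthogonal {S : Finset (TorusSite d L)} (hS : ∀ R ∈ S, ∀ R' ∈ S, R ≠ -R') (R R' : S) :
    ∑ k, cosFamily S R k * conj (cosFamily S R' k) = if R = R' then 2 * (L : ℂ) ^ d else 0 := by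
  unfold cosFamily
  rw [sum_cosChar_mul_conj hS R.2 R'.2]
  simp only [Subtype.ext_iff]

/-- `2 L^d ≠ 0`. [folklore] -/
private theorem two_mul_natCast_pow_ne_zero : (2 * (L : ℂ) ^ d) ≠ 0 :=
  mul_ne_zero two_ne_zero natCast_pow_ne_zero

/-- `0 < Re (2 L^d)`. [folklore] -/
private theorem re_two_mul_natCast_pow_pos : 0 < (2 * (L : ℂ) ^ d).re := by
  have : (2 * (L : ℂ) ^ d).re = 2 * ((L : ℂ) ^ d).re := by simp [Complex.mul_re]
  rw [this]
  exact mul_pos two_pos re_natCast_pow_pos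

/-- **Cosine form of the range-independence**: on the full grid, the least-squares fit of `ε` by real-form harmonics
`Σ_{R ∈ S} a_R c_R(k)` over representatives `S` (any truncation) is minimised exactly at
`a_R = (Σ_k ε(k) conj c_R(k)) / (2L^d) = (t_W[ε](R) + t_W[ε](−R)) / 2` — the symmetrised Wannier hopping — and only there.
[cite: HammerlinHoffman1991, Ch. 6 §6.5 (Orthogonality Relation; α̃_k = ⟨y, g_k⟩/‖g_k‖²)] -/
theorem cos_fit_eq_coeff {S : Finset (TorusSite d L)} (hS : ∀ R ∈ S, ∀ R' ∈ S, R ≠ -R') (ε : TorusSite d L → ℂ)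
    (a : S → ℂ) (ha : lsq (cosFamily S) Finset.univ ε a ≤ lsq (cosFamily S) Finset.univ ε
      (coeff (cosFamily S) (2 * (L : ℂ) ^ d) ε)) (R : S) :
    a R = coeff (cosFamily S) (2 * (L : ℂ) ^ d) ε R :=
  eq_coeff_of_lsq_le (cosFamily_orthogonal hS) re_two_mul_natCast_pow_pos Finset.univ ε a ha (Finset.mem_univ R)

/-- The cosine-fit coefficient IS the symmetrised Wannier hopping: `coeff = (t_W(R) + t_W(−R))/2`. [cite: HammerlinHoffman1991, Ch. 6 §6.5 (Orthogonality Relation; α̃_k = ⟨y, g_k⟩/‖g_k‖²)] -/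
theorem coeff_cosFamily_eq (S : Finset (TorusSite d L)) (ε : TorusSite d L → ℂ) (R : S) :
    coeff (cosFamily S) (2 * (L : ℂ) ^ d) ε R
      = (fourierHopping ε (R : TorusSite d L) + fourierHopping ε (-(R : TorusSite d L))) / 2 := by
  rw [coeff, fourierHopping_eq, fourierHopping_eq]
  have h1 : ∑ k, ε k * conj (cosFamily S R k)
      = ∑ k, ε k * conj (torusChar (R : TorusSite d L) k) + ∑ k, ε k * conj (torusChar (-(R : TorusSite d L)) k) := by
    rw [← Finset.sum_add_distrib]
    refine Finset.sum_congr rfl fun k _ => ?_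
    simp only [cosFamily, cosChar, map_add, mul_add]
  rw [h1]
  field_simp

end Cosine

end TBFit

end Literature.MathematicalPhysics.QuantumLattice
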